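import Summits.ValiantsHypothesis.ValiantsHypothesis.Theorems.LacunarySymmetroidMatrixDescartesCensusV19CSoundDict

/-!
# `MatrixDescartes` census — soundness of the CASE-C checker: a hypothetical nineteen on a checked one-collision support (full support on the `20` sums, alternation, Newton-cone rows, sign algebra of the branches)

HONEST FRAMING.  Object-search cell `pub-symmetroid`; door-A item `DoorA26 = PosRootLawAt 2 6 19`
(stmt-ValiantsHypothesis-19979; OPEN, typed, never asserted).  Part of the proof that certificates accepted by `V19C.checkSupport` (`…CensusV19CCheck`)
exclude a nineteen on a one-collision support.  Concrete layer: a pencil with `19` distinct positive det-roots on a support passing `V19C.ordOK` is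
Descartes-sharp on the `20` sums (`Census.caseC_sharp`, val-sym-door-p5 g3), so its coefficients there are non-zero and alternate and obey the
Newton-cone rows `C25` in the checker's form; plus the small sign lemmas used to place `G_A`, `G_B` in their slots.  Nothing here bears on the
`2`-Sidon supports, on `ζ_sym(2,6)` over all supports, on `DoorA26` itself, on `MatrixDescartes` (stmt-ValiantsHypothesis-18050) or on `VP ≠ VNP`.

[folklore] Certificate-checker soundness; elementary.
-/

-- the D-0017 layout repeats a namespace component (single-conjunct summit); the `dupNamespace` linter flags it; name mandated.
set_option linter.dupNamespace false

namespace Summit.ValiantsHypothesis.ValiantsHypothesis.Theorems.LacunarySymmetroidMatrixDescartes.Census.V19C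

open V20 (Atom allAtoms psum posOf qA cA Term PolySpec posl FNat fval Row rowC25 FRat negAt sgnR tval pval lprod aval qv bv pdet dfun
  dist1 lprod_append lprod_replicate fval_append fval_map_const dist1_cast_of_ne negAt_succ sgnR_succ)

section Sharp

open Polynomial Finset
open scoped BigOperators Polynomial Matrix

variable {dl : List ℕ} {ord : List Atom} {pstar : ℕ} {S : Fin 6 → Matrix (Fin 2) (Fin 2) ℝ}

/-! ### Full support and sharpness -/

/-- A nineteen has full support: the `20` sums. [folklore] -/
theorem support_eq_E (h : ordOK dl ord pstar = true)
    (h19 : 19 ≤ ((pdet dl S).roots.toFinset.filter (fun t => 0 < t)).card) :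
    (pdet dl S).support = ((ord.eraseIdx (pstar + 1)).map (psum dl)).toFinset :=
  caseC_support_eq _ _ (card_E h) (support_subset_E h S) h19

/-- A nineteen is Descartes-sharp on the `20` sums. [folklore] -/
theorem sharp (h : ordOK dl ord pstar = true)
    (h19 : 19 ≤ ((pdet dl S).roots.toFinset.filter (fun t => 0 < t)).card) :
    (pdet dl S).support.card ≤ ((pdet dl S).roots.toFinset.filter (fun t => 0 < t)).card + 1 :=
  caseC_sharp _ _ (card_E h) (support_subset_E h S) h19

/-- Every one of the `20` sums is in the support of a nineteen. [folklore] -/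
theorem E_mem_support (h : ordOK dl ord pstar = true)
    (h19 : 19 ≤ ((pdet dl S).roots.toFinset.filter (fun t => 0 < t)).card) {t : ℕ} (ht : t < 20) :
    ((ord.eraseIdx (pstar + 1)).map (psum dl)).getD t 0 ∈ (pdet dl S).support := by
  rw [support_eq_E h h19, List.mem_toFinset, List.getD_eq_getElem _ _ (by rw [length_E h]; exact ht)]
  exact List.getElem_mem _

/-- Every coefficient of a nineteen at the `20` sums is non-zero. [folklore] -/
theorem coeff_E_ne_zero (h : ordOK dl ord pstar = true)
    (h19 : 19 ≤ ((pdet dl S).roots.toFinset.filter (fun t => 0 < t)).card) {t : ℕ} (ht : t < 20) :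
    (pdet dl S).coeff (((ord.eraseIdx (pstar + 1)).map (psum dl)).getD t 0) ≠ 0 :=
  Polynomial.mem_support_iff.1 (E_mem_support h h19 ht)

/-- A support element is one of the `20` sums. [folklore] -/
theorem exists_pos_of_mem_support (h : ordOK dl ord pstar = true)
    (h19 : 19 ≤ ((pdet dl S).roots.toFinset.filter (fun t => 0 < t)).card) {e : ℕ} (he : e ∈ (pdet dl S).support) :
    ∃ u, u < 20 ∧ ((ord.eraseIdx (pstar + 1)).map (psum dl)).getD u 0 = e := by
  rw [support_eq_E h h19, List.mem_toFinset] at he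
  obtain ⟨u, hu, rfl⟩ := List.getElem_of_mem he
  refine ⟨u, by rw [length_E h] at hu; exact hu, ?_⟩
  rw [List.getD_eq_getElem _ _ hu]

/-! ### Alternation and the sign pattern -/

/-- Adjacent coefficients of a nineteen alternate in sign. [folklore] -/
theorem coeff_alternate (h : ordOK dl ord pstar = true)
    (h19 : 19 ≤ ((pdet dl S).roots.toFinset.filter (fun t => 0 < t)).card) {t : ℕ} (ht : t + 1 < 20) :
    (pdet dl S).coeff (((ord.eraseIdx (pstar + 1)).map (psum dl)).getD t 0)
      * (pdet dl S).coeff (((ord.eraseIdx (pstar + 1)).map (psum dl)).getD (t + 1) 0) < 0 := by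
  refine coeff_mul_coeff_neg_of_sharp _ (sharp h h19) (E_mem_support h h19 (by omega)) (E_mem_support h h19 ht)
    (E_lt h (Nat.lt_succ_self t) ht) ?_
  intro c hc ⟨h1, h2⟩
  obtain ⟨u, hu, rfl⟩ := exists_pos_of_mem_support h h19 hc
  have hut : t < u := by
    by_contra hle; push Not at hle
    exact absurd h1 (not_lt.2 (E_le h hle (by omega)))
  have hut' : u < t + 1 := by
    by_contra hle; push Not at hle
    exact absurd h2 (not_lt.2 (E_le h hle hu))
  omega

/-- The sign pattern of a nineteen: with `s` the sign of the lowest coefficient, the coefficient at the `t`-th sum has sign `s·(−1)^t`. [folklore] -/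
theorem sign_pattern (h : ordOK dl ord pstar = true)
    (h19 : 19 ≤ ((pdet dl S).roots.toFinset.filter (fun t => 0 < t)).card) :
    ∀ t, t < 20 → 0 < sgnR (decide (0 < (pdet dl S).coeff (((ord.eraseIdx (pstar + 1)).map (psum dl)).getD 0 0))) t
      * (pdet dl S).coeff (((ord.eraseIdx (pstar + 1)).map (psum dl)).getD t 0) := by
  intro t
  induction t with
  | zero =>
    intro _
    have hne := coeff_E_ne_zero h h19 (show 0 < 20 by norm_num)
    generalize (pdet dl S).coeff (((ord.eraseIdx (pstar + 1)).map (psum dl)).getD 0 0) = c0 at hne ⊢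
    unfold sgnR negAt
    by_cases hc : 0 < c0
    · rw [decide_eq_true hc]; simp [hc]
    · have hlt : c0 < 0 := lt_of_le_of_ne (not_lt.1 hc) hne
      rw [decide_eq_false hc]; simp; linarith
  | succ t ih =>
    intro ht
    have h1 := ih (by omega)
    have h2 := coeff_alternate h h19 ht
    rw [sgnR_succ]
    have hg1 : sgnR (decide (0 < (pdet dl S).coeff (((ord.eraseIdx (pstar + 1)).map (psum dl)).getD 0 0))) t = 1 ∨
        sgnR (decide (0 < (pdet dl S).coeff (((ord.eraseIdx (pstar + 1)).map (psum dl)).getD 0 0))) t = -1 := by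
      unfold sgnR; split_ifs <;> simp
    rcases hg1 with e | e <;> rw [e] at h1 ⊢ <;> nlinarith

/-- The sign pattern in the form `coeff = sgnR · |coeff|`. [folklore] -/
theorem coeff_eq_sgnR_mul_abs (h : ordOK dl ord pstar = true)
    (h19 : 19 ≤ ((pdet dl S).roots.toFinset.filter (fun t => 0 < t)).card) {t : ℕ} (ht : t < 20) :
    (pdet dl S).coeff (((ord.eraseIdx (pstar + 1)).map (psum dl)).getD t 0)
      = sgnR (decide (0 < (pdet dl S).coeff (((ord.eraseIdx (pstar + 1)).map (psum dl)).getD 0 0))) t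
        * |(pdet dl S).coeff (((ord.eraseIdx (pstar + 1)).map (psum dl)).getD t 0)| := by
  have h1 := sign_pattern h h19 t ht
  have hg1 : sgnR (decide (0 < (pdet dl S).coeff (((ord.eraseIdx (pstar + 1)).map (psum dl)).getD 0 0))) t = 1 ∨
      sgnR (decide (0 < (pdet dl S).coeff (((ord.eraseIdx (pstar + 1)).map (psum dl)).getD 0 0))) t = -1 := by
    unfold sgnR; split_ifs <;> simp
  rcases hg1 with e | e <;> rw [e] at h1 ⊢
  · rw [one_mul] at h1; rw [one_mul, abs_of_pos h1]
  · have : (pdet dl S).coeff (((ord.eraseIdx (pstar + 1)).map (psum dl)).getD t 0) < 0 := by linarith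
    rw [abs_of_neg this]; ring

/-! ### Newton-cone rows in the checker's form -/

/-- The Newton-cone gap weight over the `20` sums as the checker computes it. [folklore] -/
theorem weight_eq (h : ordOK dl ord pstar = true)
    (h19 : 19 ≤ ((pdet dl S).roots.toFinset.filter (fun t => 0 < t)).card) (e : ℕ) :
    ∏ u ∈ (pdet dl S).support.erase e, |(e : ℝ) - u| = (((((ord.eraseIdx (pstar + 1)).map (psum dl)).map (dist1 e)).prod : ℕ) : ℝ) := by
  rw [support_eq_E h h19]
  have h1 : ∏ u ∈ ((ord.eraseIdx (pstar + 1)).map (psum dl)).toFinset.erase e, |(e : ℝ) - u|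
      = ∏ u ∈ ((ord.eraseIdx (pstar + 1)).map (psum dl)).toFinset.erase e, ((dist1 e u : ℕ) : ℝ) :=
    Finset.prod_congr rfl fun u hu => (dist1_cast_of_ne (Finset.ne_of_mem_erase hu)).symm
  rw [h1, Finset.prod_erase _ (by simp [dist1]), List.prod_toFinset _ (E_nodup h), Nat.cast_list_prod]
  simp only [List.map_map, Function.comp_def]

/-- The Newton-cone row `C25(t)` on the `20` sums in the checker's form, for `x t = |coeff (E t)|`. [folklore] -/
theorem rowC25_of_nineteen (h : ordOK dl ord pstar = true)
    (h19 : 19 ≤ ((pdet dl S).roots.toFinset.filter (fun t => 0 < t)).card) (x : ℕ → ℝ)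
    (hx : ∀ t, t < 20 → x t = |(pdet dl S).coeff (((ord.eraseIdx (pstar + 1)).map (psum dl)).getD t 0)|) {t : ℕ} (h1 : 1 ≤ t)
    (h18 : t ≤ 18) : (rowC25 ((ord.eraseIdx (pstar + 1)).map (psum dl)) t).Holds x := by
  unfold Row.Holds
  have hpq := E_lt h (show t - 1 < t by omega) (show t < 20 by omega)
  have hqr := E_lt h (show t < t + 1 by omega) (show t + 1 < 20 by omega)
  have newton := newton_cone_coeff (pdet dl S) (sharp h h19) (E_mem_support h h19 (show t - 1 < 20 by omega))
    (E_mem_support h h19 (show t < 20 by omega)) (E_mem_support h h19 (show t + 1 < 20 by omega)) hpq hqr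
  rw [weight_eq h h19, weight_eq h h19, weight_eq h h19, ← hx (t - 1) (by omega), ← hx t (by omega),
    ← hx (t + 1) (by omega)] at newton
  generalize hE : (ord.eraseIdx (pstar + 1)).map (psum dl) = E at newton hpq hqr
  generalize hp : E.getD (t - 1) 0 = p at newton hpq
  generalize hq : E.getD t 0 = q at newton hpq hqr
  generalize hr : E.getD (t + 1) 0 = r at newton hqr
  have eL : (rowC25 E t).L = List.replicate (r - q) (t - 1) ++ List.replicate (q - p) (t + 1) := by
    simp only [rowC25, hp, hq, hr]
  have eR : (rowC25 E t).R = List.replicate (q - p + (r - q)) t := by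
    simp only [rowC25, hp, hq, hr]
  have eBnum : fval (rowC25 E t).Bnum = (E.map (dist1 q)).prod ^ (q - p + (r - q)) := by
    simp only [rowC25, hp, hq, hr]
    exact fval_map_const _ _ _
  have eBden : fval (rowC25 E t).Bden = (E.map (dist1 p)).prod ^ (r - q) * (E.map (dist1 r)).prod ^ (q - p) := by
    simp only [rowC25, hp, hq, hr]
    rw [fval_append, fval_map_const, fval_map_const]
  rw [eL, eR, eBnum, eBden, lprod_append, lprod_replicate, lprod_replicate, lprod_replicate]
  simp only [Nat.cast_mul, Nat.cast_pow]
  rw [show r - p = q - p + (r - q) by omega] at newton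
  rw [mul_pow, mul_pow, mul_pow] at newton
  have key := newton
  ring_nf at key ⊢
  exact key

/-! ### Sign algebra of the branches -/

/-- `sgnR` is `±1`. [folklore] -/
theorem sgnR_cases (s : Bool) (t : ℕ) : sgnR s t = 1 ∨ sgnR s t = -1 := by
  unfold sgnR; split_ifs <;> simp

/-- A real of the same sign as `c`, where `c` has sign `σ = ±1`, is `σ · |y|`. [folklore] -/
theorem eq_sgn_mul_abs_of_same {y c σ : ℝ} (hσ : σ = 1 ∨ σ = -1) (hc : 0 < σ * c) (hy : 0 < y * c) : y = σ * |y| := by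
  rcases hσ with rfl | rfl
  · have : 0 < y := by nlinarith
    rw [one_mul, abs_of_pos this]
  · have : y < 0 := by nlinarith
    rw [abs_of_neg this]; ring

/-- A real of the sign opposite to `c`, where `c` has sign `σ = ±1`, is `−σ · |y|`. [folklore] -/
theorem eq_neg_sgn_mul_abs_of_opp {y c σ : ℝ} (hσ : σ = 1 ∨ σ = -1) (hc : 0 < σ * c) (hy : y * c < 0) : y = -σ * |y| := by
  rcases hσ with rfl | rfl
  · have : y < 0 := by nlinarith
    rw [abs_of_neg this]; ring
  · have : 0 < y := by nlinarith
    rw [abs_of_pos this]; ring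

variable {s : Bool} {br : Br}

/-- The real sign of a position slot is the alternating sign. [folklore] -/
theorem sgR_lt_20 {t : ℕ} (ht : t < 20) : sgR (mkCtx dl ord pstar s br) t = sgnR s t := by
  unfold sgR zeroSlot negSlot sgnR
  have h1 : (t == 20) = false := by simp; omega
  have h2 : (t == 21) = false := by simp; omega
  simp [mkCtx, h1, h2, ht]

/-- The real sign of slot `20` (`G_A`): `0` in `ZA`, opposite to `c⋆` in `MP`, else that of `c⋆`. [folklore] -/
theorem sgR_20 : sgR (mkCtx dl ord pstar s br) 20
    = if br = .ZA then 0 else if br = .MP then -sgnR s pstar else sgnR s pstar := by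
  unfold sgR zeroSlot negSlot sgnR
  cases br <;> cases hn : negAt s pstar <;> simp [mkCtx, hn]

/-- The real sign of slot `21` (`G_B`): `0` in `ZB`, opposite to `c⋆` in `PM`, else that of `c⋆`. [folklore] -/
theorem sgR_21 : sgR (mkCtx dl ord pstar s br) 21
    = if br = .ZB then 0 else if br = .PM then -sgnR s pstar else sgnR s pstar := by
  unfold sgR zeroSlot negSlot sgnR
  cases br <;> cases hn : negAt s pstar <;> simp [mkCtx, hn]

end Sharp

end Summit.ValiantsHypothesis.ValiantsHypothesis.Theorems.LacunarySymmetroidMatrixDescartes.Census.V19C
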